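import Summits.HodgeConjecture.HodgeConjecture.Theorems.K2E1bCubicCasimirCentral
import HarnessLib

/-!
# K2 ∕ E1b — LAWS BRICK U8-4c-B (1∕2) «the cubic Gelfand invariant on an extreme vector»

Cell hodgecm-mathlib, Track B «K2-LIT», engine E1b, unit U8 «archimedean packet signs»; crux item h413 = stmt-HodgeConjecture-24833
(supports-only helper; closes nothing by itself).  Default take of K2-defs1 (g3) 2026-09-04T03:04Z, «=» GO by K2E1b-plan (g3) 03:09Z, box-side
pre-check K2E1b-r01 (g4) 03:11Z (both identities independently re-derived), under the U8-4c programme of TABLE ED. 8 §2d («cubic LAWS: centrality ★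
p856845, class-invariance ★ p856845, CALIBRATION»).  Sequel to ★ `K2E1bCubicCasimirDefs` (`upqCubicOp`, `HasCubicScalar`, `cubicOf`) and ★
`K2E1bCubicCasimirCentral` (`upqCubicOp_ρ𝔤_apply`).  THEOREMS ONLY — no definition, no `sorry`, no axiom, no instance (one
`attribute [local instance] LieRing.ofAssociativeRing`, the Mathlib idiom of every ★ `Upq*` file), no notation; GENERIC (no record internals).
Part 2∕2 = `Theorems/K2E1bCubicCasimirTwistCorner.lean` (the twist dictionary for a Kovačević datum and the corner-vector engine).

## What is proved

* §0 (general: commutative ring `R`, `R`-module `V`, finite index type `ι`, Lie homomorphism `ρ : 𝔤𝔩(ι, R) → End_R V`):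
  `lieHom_single_apply_comm` — `E_ij (E_kl v) = E_kl (E_ij v) + δ_jk E_il v − δ_li E_kj v` (`E_ij := ρ(Matrix.single i j 1)`); and
  **`cubicSum_apply_extreme`** — if `ι = {p, q, r}` (three distinct indices), `E_pq u = E_pr u = E_qr u = 0` and `E_pp u = μ_p u`, `E_qq u = μ_q u`,
  `E_rr u = μ_r u`, then `(Σ_{ijk} E_ij E_jk E_ki) u = P(μ_p + 1, μ_q, μ_r − 1) • u` with
  `P(x, y, z) = x³ + y³ + z³ + (x² + y² + z² − xy − yz − zx) − 2(x + y + z) − 3` (written out; no new `def`)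
  — the PERELOMOV–POPOV value of the cubic Gelfand invariant at the Harish-Chandra parameter «highest weight + ρ_B» of the Borel `B ∋ E_pq, E_pr, E_qr`
  [Iachello2015, (7.24)]; [Molev2007, §7.1].  PROOF = normal ordering of the 27 words `E_ij E_jk E_ki u` (annihilators and diagonal units pushed
  inward with `lieHom_single_apply_comm`), kernel-checked by `simp only […]; module`; no PBW theorem, no Harish-Chandra isomorphism is used.
* §1 (`𝔲(2,1)`-modules, `ρ_ℂ = upqLieC ρ𝔤`, indices `inl 0, inl 1, inr 0` of `Fin 2 ⊕ Fin 1` written `0, 1, 2`): **`upqCubicOp_apply_of_extreme_top`**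
  (`E₀₁ u = E₀₂ u = E₁₂ u = 0` ⇒ `C₃ u = P(μ₀ + 1, μ₁, μ₂ − 1) u`) and **`upqCubicOp_apply_of_extreme_bottom`** (`E₀₁ u = E₂₀ u = E₂₁ u = 0` ⇒
  `C₃ u = P(μ₂ + 1, μ₀, μ₁ − 1) u`; §0 with `(p, q, r) = (2, 0, 1)` — the Borel of a lowest-`m` corner `K`-type); and `cubicOf_cast`: `P` at integer points
  IS ★ `cubicOf` read in `ℂ`.
* §2 ONE EIGENVECTOR SUFFICES: if every `ρ𝔤`-stable `ℂ`-subspace of `V` is `⊥` or `⊤` and `C₃ u = s u` for some `u ≠ 0`, then `HasCubicScalar ρ𝔤 s`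
  (`hasCubicScalar_of_eigenvector`: the eigenspace is `ρ𝔤`-stable by centrality ★ `upqCubicOp_ρ𝔤_apply`) — the pattern of ★
  `Kovacevic2021.SU21Datum.exists_casimir_eq_smul_one_of_isIrreducible`; and `HasCubicScalar.of_eq` (reshape the scalar by `ring`).

REACH (honest, K2E1b-r01 (g4) 03:11Z): Borel-extreme corner vectors exist for the record cells `j = 1` (`D_φ⁺`, bottom corner) and `j = 2` (`D_φ⁻`, top
corner) — paper pre-check: `P = cubicOf a b c` there, 0 mismatches; the middle cell `j = 0` (`D_φ`) has NO extreme vector for the compact Cartan's Borels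
(its vertex `K`-type is a local minimum of the arrow graph) and is not reached by the corner method — it needs the propagation of the `C₃`-scalar along
Kovačević's `(+)`-series module (centrality + multiplicity-one `K`-types), a separate brick.

Sources: [Iachello2015] F. Iachello, *Lie Algebras and Applications*, 2nd ed., LNP 891 (2015), §7.4.1 (7.20)–(7.24) (eigenvalues of the Gelfand
invariants on a highest weight; original A. M. Perelomov, V. S. Popov, Sov. J. Nucl. Phys. 3 (1966) 676–680); [Molev2007] A. Molev, *Yangians and
Classical Lie Algebras*, AMS Surveys 143 (2007), §7.1; [BorelWallach2000] II §2.3, §2.5 (a central operator with an eigenvector on an irreducible module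
is a scalar); [KnappVogan1995] Prop. 4.120.

HONEST LABEL: HC_CM is proved only modulo the 7 printed citations (2 remaining named inputs: hLiu418 = stmt-HodgeConjecture-24832,
h413 = stmt-HodgeConjecture-24833) until rung 0 closes; LAWS bricks close nothing by themselves.
-/

set_option autoImplicit false
set_option linter.dupNamespace false

noncomputable section

namespace Summit.HodgeConjecture.HodgeConjecture.Cruxes.H413.K2E1bGKCohomologyU21

open Literature.NumberTheory.Automorphic
open Literature.RepresentationTheory
open Literature.RepresentationTheory.KonnoKonno2007 Literature.RepresentationTheory.KonnoKonno2007.RealDualPair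
open Literature.RepresentationTheory.KonnoKonno2007.RealDualPair.UForm

-- Mathlib idiom (as in `GKModules`, the `Upq*` files, ★ `K2E1bCubicCasimirDefs`): commutator bracket on associative algebras
attribute [local instance 100] LieRing.ofAssociativeRing

/-! ## §0 The cubic Gelfand invariant on an extreme vector: normal ordering over `𝔤𝔩(ι, R)`, `ι = {p, q, r}` -/

section Extreme

variable {R : Type*} [CommRing R] {V : Type*} [AddCommGroup V] [Module R V]
  {ι : Type*} [Fintype ι] [DecidableEq ι]

/-- The commutator of two matrix units: `[E_{ij}, E_{kl}] = δ_{jk} E_{il} − δ_{li} E_{kj}`. [folklore] -/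
private theorem single_comm_single (i j k l : ι) :
    Matrix.single i j (1 : R) * Matrix.single k l 1 - Matrix.single k l 1 * Matrix.single i j 1 =
      (if j = k then Matrix.single i l 1 else 0) - (if l = i then Matrix.single k j 1 else 0) := by
  congr 1
  · split_ifs with h
    · subst h; rw [Matrix.single_mul_single_same, mul_one]
    · simp [Matrix.single_mul_single_of_ne, h]
  · split_ifs with h
    · subst h; rw [Matrix.single_mul_single_same, mul_one]
    · simp [Matrix.single_mul_single_of_ne, h]

/-- **Pointwise commutation of matrix units through a Lie homomorphism** `ρ : 𝔤𝔩(ι, R) → End_R V`: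
`E_ij (E_kl v) = E_kl (E_ij v) + δ_jk E_il v − δ_li E_kj v` (`E_ij := ρ(Matrix.single i j 1)`) — the rewriting rule of the normal ordering.
[cite: Molev2007, §7.1] -/
theorem lieHom_single_apply_comm (ρ : Matrix ι ι R →ₗ⁅R⁆ Module.End R V) (i j k l : ι) (v : V) :
    ρ (Matrix.single i j 1) (ρ (Matrix.single k l 1) v) =
      ρ (Matrix.single k l 1) (ρ (Matrix.single i j 1) v)
        + (if j = k then ρ (Matrix.single i l 1) v else 0) - (if l = i then ρ (Matrix.single k j 1) v else 0) := by
  have h : ρ (Matrix.single i j 1) * ρ (Matrix.single k l 1) - ρ (Matrix.single k l 1) * ρ (Matrix.single i j 1) =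
      (if j = k then ρ (Matrix.single i l 1) else 0) - (if l = i then ρ (Matrix.single k j 1) else 0) := by
    rw [← LieRing.of_associative_ring_bracket, ← LieHom.map_lie, LieRing.of_associative_ring_bracket,
      single_comm_single, map_sub]
    congr 1 <;> split_ifs <;> simp
  have h' := LinearMap.congr_fun h v
  have e1 : (if j = k then ρ (Matrix.single i l 1) else 0) v = if j = k then ρ (Matrix.single i l 1) v else 0 := by
    split_ifs <;> rfl
  have e2 : (if l = i then ρ (Matrix.single k j 1) else 0) v = if l = i then ρ (Matrix.single k j 1) v else 0 := by
    split_ifs <;> rfl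
  rw [LinearMap.sub_apply, LinearMap.sub_apply, Module.End.mul_apply, Module.End.mul_apply, e1, e2] at h'
  rw [sub_eq_iff_eq_add] at h'
  rw [h']
  abel

/-- **The cubic Gelfand invariant on an extreme vector.**  If `ι = {p, q, r}` (distinct), `u` is annihilated by the three matrix units
`E_pq, E_pr, E_qr` of the Borel they span, and the diagonal units act on `u` by `μ_p, μ_q, μ_r`, then
`(Σ_{ijk} E_ij E_jk E_ki) u = P(μ_p + 1, μ_q, μ_r − 1) u` with `P(x,y,z) = x³+y³+z³+(x²+y²+z²−xy−yz−zx)−2(x+y+z)−3` — the Perelomov–Popov value at the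
Harish-Chandra parameter `λ + ρ_B`, obtained by normal-ordering the 27 words (each annihilator ∕ diagonal unit is pushed inward with
`lieHom_single_apply_comm`; what is left is a polynomial in `μ` times `u`). [cite: Iachello2015, (7.24)] [cite: Molev2007, §7.1] -/
theorem cubicSum_apply_extreme (ρ : Matrix ι ι R →ₗ⁅R⁆ Module.End R V) {p q r : ι}
    (hpq : p ≠ q) (hqr : q ≠ r) (hpr : p ≠ r) (huniv : (Finset.univ : Finset ι) = {p, q, r})
    {u : V} {μp μq μr : R}
    (hp : ρ (Matrix.single p p 1) u = μp • u) (hq : ρ (Matrix.single q q 1) u = μq • u) (hr : ρ (Matrix.single r r 1) u = μr • u)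
    (hpq0 : ρ (Matrix.single p q 1) u = 0) (hpr0 : ρ (Matrix.single p r 1) u = 0) (hqr0 : ρ (Matrix.single q r 1) u = 0) :
    (∑ i, ∑ j, ∑ k, ρ (Matrix.single i j 1) * ρ (Matrix.single j k 1) * ρ (Matrix.single k i 1)) u =
      ((μp + 1) ^ 3 + μq ^ 3 + (μr - 1) ^ 3
        + ((μp + 1) ^ 2 + μq ^ 2 + (μr - 1) ^ 2 - (μp + 1) * μq - μq * (μr - 1) - (μr - 1) * (μp + 1))
        - 2 * ((μp + 1) + μq + (μr - 1)) - 3) • u := by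
  have sum3 : ∀ f : ι → Module.End R V, ∑ i, f i = f p + f q + f r := by
    intro f
    rw [huniv, Finset.sum_insert (by simp [hpq, hpr]), Finset.sum_insert (by simp [hqr]), Finset.sum_singleton, add_assoc]
  simp only [sum3, LinearMap.add_apply, Module.End.mul_apply]
  simp only [hp, hq, hr, hpq0, hpr0, hqr0, map_zero, map_smul, map_add, map_sub, smul_zero, smul_sub, smul_smul, zero_add,
    add_zero, sub_zero, hpq, hqr, hpr, hpq.symm, hqr.symm, if_true, if_false,
    lieHom_single_apply_comm ρ q q q p, lieHom_single_apply_comm ρ r r q p, lieHom_single_apply_comm ρ r r r p,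
    lieHom_single_apply_comm ρ r r r q, lieHom_single_apply_comm ρ p q q p, lieHom_single_apply_comm ρ p r q p,
    lieHom_single_apply_comm ρ p r r p, lieHom_single_apply_comm ρ p r r q, lieHom_single_apply_comm ρ q r r p,
    lieHom_single_apply_comm ρ q r r q]
  module

end Extreme

/-! ## §1 `upqCubicOp` on an extreme vector of a `(𝔲(α, β), K)`-module (`α ⊕ β = Fin 2 ⊕ Fin 1`) -/

section Upq

variable {V : Type*} [AddCommGroup V] [Module ℂ V] (ρ𝔤 : (uFormGroup (Fin 2) (Fin 1)).lie →ₗ⁅ℝ⁆ Module.End ℂ V)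

/-- `Fin 2 ⊕ Fin 1 = {inl 0, inl 1, inr 0}`. [folklore] -/
theorem univ_fin2_sum_fin1 : (Finset.univ : Finset (Fin 2 ⊕ Fin 1)) = {Sum.inl 0, Sum.inl 1, Sum.inr 0} := by
  ext x
  simp only [Finset.mem_univ, Finset.mem_insert, Finset.mem_singleton, true_iff]
  rcases x with x | x
  · fin_cases x <;> simp
  · fin_cases x; simp

/-- **`C₃` on a TOP extreme vector** (killed by the upper units `E₀₁, E₀₂, E₁₂`; diagonal weights `μ₀, μ₁, μ₂`):
`upqCubicOp ρ𝔤 u = P(μ₀ + 1, μ₁, μ₂ − 1) • u`. [cite: Iachello2015, (7.24)] [cite: Molev2007, §7.1] -/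
theorem upqCubicOp_apply_of_extreme_top {u : V} {μ₀ μ₁ μ₂ : ℂ}
    (h00 : upqLieC ρ𝔤 (Matrix.single (Sum.inl 0) (Sum.inl 0) 1) u = μ₀ • u)
    (h11 : upqLieC ρ𝔤 (Matrix.single (Sum.inl 1) (Sum.inl 1) 1) u = μ₁ • u)
    (h22 : upqLieC ρ𝔤 (Matrix.single (Sum.inr 0) (Sum.inr 0) 1) u = μ₂ • u)
    (h01 : upqLieC ρ𝔤 (Matrix.single (Sum.inl 0) (Sum.inl 1) 1) u = 0)
    (h02 : upqLieC ρ𝔤 (Matrix.single (Sum.inl 0) (Sum.inr 0) 1) u = 0)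
    (h12 : upqLieC ρ𝔤 (Matrix.single (Sum.inl 1) (Sum.inr 0) 1) u = 0) :
    upqCubicOp ρ𝔤 u =
      ((μ₀ + 1) ^ 3 + μ₁ ^ 3 + (μ₂ - 1) ^ 3
        + ((μ₀ + 1) ^ 2 + μ₁ ^ 2 + (μ₂ - 1) ^ 2 - (μ₀ + 1) * μ₁ - μ₁ * (μ₂ - 1) - (μ₂ - 1) * (μ₀ + 1))
        - 2 * ((μ₀ + 1) + μ₁ + (μ₂ - 1)) - 3) • u := by
  rw [upqCubicOp_eq]
  exact cubicSum_apply_extreme (upqLieC ρ𝔤) (p := Sum.inl 0) (q := Sum.inl 1) (r := Sum.inr 0)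
    (by simp) (by simp) (by simp) univ_fin2_sum_fin1 h00 h11 h22 h01 h02 h12

/-- **`C₃` on a BOTTOM extreme vector** (killed by `E₀₁, E₂₀, E₂₁` — the Borel of a lowest-`m` corner `K`-type; diagonal weights `μ₀, μ₁, μ₂`):
`upqCubicOp ρ𝔤 u = P(μ₂ + 1, μ₀, μ₁ − 1) • u` (§0 with `(p, q, r) = (2, 0, 1)`). [cite: Iachello2015, (7.24)] [cite: Molev2007, §7.1] -/
theorem upqCubicOp_apply_of_extreme_bottom {u : V} {μ₀ μ₁ μ₂ : ℂ}
    (h00 : upqLieC ρ𝔤 (Matrix.single (Sum.inl 0) (Sum.inl 0) 1) u = μ₀ • u)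
    (h11 : upqLieC ρ𝔤 (Matrix.single (Sum.inl 1) (Sum.inl 1) 1) u = μ₁ • u)
    (h22 : upqLieC ρ𝔤 (Matrix.single (Sum.inr 0) (Sum.inr 0) 1) u = μ₂ • u)
    (h01 : upqLieC ρ𝔤 (Matrix.single (Sum.inl 0) (Sum.inl 1) 1) u = 0)
    (h20 : upqLieC ρ𝔤 (Matrix.single (Sum.inr 0) (Sum.inl 0) 1) u = 0)
    (h21 : upqLieC ρ𝔤 (Matrix.single (Sum.inr 0) (Sum.inl 1) 1) u = 0) :
    upqCubicOp ρ𝔤 u =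
      ((μ₂ + 1) ^ 3 + μ₀ ^ 3 + (μ₁ - 1) ^ 3
        + ((μ₂ + 1) ^ 2 + μ₀ ^ 2 + (μ₁ - 1) ^ 2 - (μ₂ + 1) * μ₀ - μ₀ * (μ₁ - 1) - (μ₁ - 1) * (μ₂ + 1))
        - 2 * ((μ₂ + 1) + μ₀ + (μ₁ - 1)) - 3) • u := by
  rw [upqCubicOp_eq]
  have huniv : (Finset.univ : Finset (Fin 2 ⊕ Fin 1)) = {Sum.inr 0, Sum.inl 0, Sum.inl 1} := by
    rw [univ_fin2_sum_fin1]
    ext x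
    simp only [Finset.mem_insert, Finset.mem_singleton]
    tauto
  exact cubicSum_apply_extreme (upqLieC ρ𝔤) (p := Sum.inr 0) (q := Sum.inl 0) (r := Sum.inl 1)
    (by simp) (by simp) (by simp) huniv h22 h00 h11 h20 h21 h01

/-- **`P` at integer points is ★ `cubicOf`**: `P(a, b, c) = cubicOf a b c` read in `ℂ`. [cite: Iachello2015, (7.24)] -/
theorem cubicOf_cast (a b c : ℤ) :
    ((cubicOf a b c : ℤ) : ℂ) =
      (a : ℂ) ^ 3 + (b : ℂ) ^ 3 + (c : ℂ) ^ 3 + ((a : ℂ) ^ 2 + (b : ℂ) ^ 2 + (c : ℂ) ^ 2 - a * b - b * c - c * a) - 2 * (a + b + c) - 3 := by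
  unfold cubicOf
  push_cast
  ring

/-! ## §2 One eigenvector suffices on an irreducible module -/

variable {ρ𝔤} in
/-- **One eigenvector ⇒ cubic scalar.**  If every `ρ𝔤`-stable `ℂ`-subspace of `V` is `⊥` or `⊤` and `C₃ u = s·u` for some `u ≠ 0`, then `C₃ = s·1`:
the `s`-eigenspace of `C₃` is `ρ𝔤`-stable by centrality (★ `upqCubicOp_ρ𝔤_apply`) and non-zero. [cite: BorelWallach2000, II §2.3, §2.5] -/
theorem hasCubicScalar_of_eigenvector
    (hirr : ∀ W : Submodule ℂ V, (∀ (X : (uFormGroup (Fin 2) (Fin 1)).lie) (w : V), w ∈ W → ρ𝔤 X w ∈ W) → W = ⊥ ∨ W = ⊤)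
    {u : V} (hu : u ≠ 0) {s : ℂ} (hs : upqCubicOp ρ𝔤 u = s • u) : HasCubicScalar ρ𝔤 s := by
  let W : Submodule ℂ V := LinearMap.ker (upqCubicOp ρ𝔤 - s • (1 : Module.End ℂ V))
  have hmem : ∀ v : V, v ∈ W ↔ upqCubicOp ρ𝔤 v = s • v := fun v => by
    change v ∈ LinearMap.ker (upqCubicOp ρ𝔤 - s • (1 : Module.End ℂ V)) ↔ _
    rw [LinearMap.mem_ker, LinearMap.sub_apply, LinearMap.smul_apply, Module.End.one_apply, sub_eq_zero]
  have hW : ∀ (X : (uFormGroup (Fin 2) (Fin 1)).lie) (w : V), w ∈ W → ρ𝔤 X w ∈ W := by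
    intro X w hw
    rw [hmem] at hw ⊢
    rw [upqCubicOp_ρ𝔤_apply, hw, map_smul]
  rcases hirr W hW with h | h
  · exact absurd ((Submodule.mem_bot ℂ).1 (h ▸ (hmem u).2 hs)) hu
  · exact fun v => (hmem v).1 (h ▸ Submodule.mem_top)

end Upq

/-- Transport of a cubic scalar along an equality of scalars (for `ring`-reshaping the value). [folklore] -/
theorem HasCubicScalar.of_eq {V : Type*} [AddCommGroup V] [Module ℂ V] {ρ𝔤 : (uFormGroup (Fin 2) (Fin 1)).lie →ₗ⁅ℝ⁆ Module.End ℂ V}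
    {s t : ℂ} (h : HasCubicScalar ρ𝔤 s) (hst : s = t) : HasCubicScalar ρ𝔤 t :=
  hst ▸ h


end Summit.HodgeConjecture.HodgeConjecture.Cruxes.H413.K2E1bGKCohomologyU21

end
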